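import Mathlib
import HarnessLib
import Summits.Ventures.LatticeQCDFlow.Scaling.Conjectures

/-!
# LatticeQCDFlow / Scaling — (C3′) `PerfectRelaxationDominates` is FALSE: a three-state, two-layer counterexample

HONEST FRAMING: exact (Metropolis-corrected) sampling algorithms for lattice gauge theory; figures of merit are
autocorrelation/cost numbers at stated couplings and volumes; no continuum-physics claim.

Venture `LatticeQCDFlow` (cell pub-lqcd), topic `Scaling`, FANOUT row 30 (lean-1) — OUR WORK, a REFUTATION of the
conjecture item `Conjectures.PerfectRelaxationDominates` ((C3′), THEORY-2.md §3.5 v1.5.1: "for monotone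
one-parameter protocols with row-stochastic, detailed-balance AND positive-semidefinite layers the NE-MCMC / SNF
effective sample size is at most its perfect-relaxation value `Π_k ESS(p_{k+1}, p_k)`").

WHY IT FAILS.  For `n = 2` layers only the first kernel `P₀` matters (the work does not involve the last
configuration), and with `u = e^{-(β₁-β₀)A}`, `v = e^{-2(β₂-β₁)A}` one finds
`E_fwd[e^{-2W}] - E_perfect[e^{-2W}] = (Z₁/Z₀)·⟨u, (P₀ - Π₁) v⟩_{p₁}` (`Π₁` = perfect relaxation onto `p₁`).
Positive semidefiniteness of `P₀` controls `⟨u, (P₀ - Π₁) u⟩ ≥ 0`, NOT the mixed term: `u` and `v` are both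
decreasing in `A` but not proportional, so a RANK-ONE positive perturbation `P₀(x,y) = p₁(y)(1 + λφ(x)φ(y))`
(`φ ⊥ 1` in `ℓ²(p₁)`, `λ ≥ 0` small: row-stochastic, positive entries, reversible for `p₁`, PSD) with
`⟨u,φ⟩⟨φ,v⟩ < 0` makes `E_fwd[e^{-2W}]` SMALLER, i.e. the ESS LARGER than under perfect relaxation.

THE WITNESS (exact rationals).  `X = Fin 3`, `A = (1, 2, 3)·log 2`, `β = (1, 2, 4)` (so all Gibbs weights are
powers of `1/2`: `p₀ = (4,2,1)/7`, `p₁ = (16,4,1)/21`, `p₂ = (256,16,1)/273`), `φ = (-1, 20, -64)/21`,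
`λ = 3969/81920`, `P₀(x,y) = p₁(y)(1 + λφ(x)φ(y))` = rows `(81929/107520, 4087/21504, 1289/26880)`,
`(4087/5376, 1069/5376, 55/1344)`, `(1289/1680, 55/336, 29/420)`; `P₁(x,y) = p₂(y)`.  Then
`ESS(path) = 596232/809981 = 0.736106…  >  ESS_perfect = (63/73)·(1183/1387) = 74529/101251 = 0.736082…`
(`theorem not_perfectRelaxationDominates`; violation `2.45·10⁻⁵`, exact; a float search over random such
layers violates in ≈ 3 % of draws by up to `0.7 %`, folder `work/c3/c3test.py`).  Theory-2's own evidence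
(lazy heat-bath / lazy-Metropolis layers, 0/8500 violations) is consistent: those layers are `Π + ε(I - Π)`-like,
for which the mixed term is `ε·Cov_{p₁}(u,v) ≥ 0` (Chebyshev).  A repaired (C3″) therefore needs a hypothesis on
the LAYERS' spectral structure (e.g. `P_k - Π_{k+1}` a non-negative mixture of `I - Π_{k+1}`-type or
monotone-kernel terms), not just positivity.  Elementary; nothing here is cited as a fact.
-/

noncomputable section

namespace Summit.Ventures.LatticeQCDFlow.Conjectures

open Finset Summit.Ventures.LatticeQCDFlow

namespace C3Witness

/-- Integer action levels `a = (1, 2, 3)`. [folklore] -/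
def a : Fin 3 → ℕ := ![1, 2, 3]

/-- Integer inverse temperatures `b = (1, 2, 4)` (monotone). [folklore] -/
def b : Fin 3 → ℕ := ![1, 2, 4]

/-- The action `A(x) = a(x)·log 2`, so that `e^{-βA}` is a power of `1/2`. [folklore] -/
def A (x : Fin 3) : ℝ := (a x : ℝ) * Real.log 2

/-- The protocol `β = (1, 2, 4)`. [folklore] -/
def β (k : Fin 3) : ℝ := (b k : ℝ)

/-- The two layers: `P₀(x,y) = p₁(y)(1 + λφ(x)φ(y))` (rank-one PSD perturbation of perfect relaxation onto
`p₁ = (16,4,1)/21`, `φ = (-1,20,-64)/21`, `λ = 3969/81920`) and `P₁(x,y) = p₂(y)` (perfect relaxation onto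
`p₂ = (256,16,1)/273`). [folklore] -/
def P : Fin 2 → Fin 3 → Fin 3 → ℝ :=
  ![![![81929 / 107520, 4087 / 21504, 1289 / 26880],
      ![4087 / 5376, 1069 / 5376, 55 / 1344],
      ![1289 / 1680, 55 / 336, 29 / 420]],
    ![![256 / 273, 16 / 273, 1 / 273],
      ![256 / 273, 16 / 273, 1 / 273],
      ![256 / 273, 16 / 273, 1 / 273]]]

/-- The Gibbs weights are powers of `1/2`: `exp(-(p·(q·log 2))) = (2^{pq})⁻¹`. [folklore] -/
theorem exp_neg_mul_mul_log_two (p q : ℕ) :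
    Real.exp (-((p : ℝ) * ((q : ℝ) * Real.log 2))) = ((2 : ℝ) ^ (p * q))⁻¹ := by
  rw [show -((p : ℝ) * ((q : ℝ) * Real.log 2)) = ((p * q : ℕ) : ℝ) * (-Real.log 2) by push_cast; ring,
    Real.exp_nat_mul, Real.exp_neg, Real.exp_log two_pos, inv_pow]

/-- Sums over paths of length three are triple sums. [folklore] -/
theorem sum_path_three (F : (Fin (2 + 1) → Fin 3) → ℝ) :
    ∑ ω : Fin (2 + 1) → Fin 3, F ω = ∑ x₀ : Fin 3, ∑ x₁ : Fin 3, ∑ x₂ : Fin 3, F ![x₀, x₁, x₂] := by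
  rw [Exactness.sum_path_cons]
  refine Finset.sum_congr rfl fun x₀ _ => ?_
  rw [Exactness.sum_path_cons]
  refine Finset.sum_congr rfl fun x₁ _ => ?_
  rw [Exactness.sum_path_zero]
  refine Finset.sum_congr rfl fun x₂ _ => ?_
  congr 1
  funext i
  fin_cases i <;> rfl

/-- `β` is monotone. [folklore] -/
theorem monotone_β : Monotone β := by
  intro i j hij
  have hb : Monotone b := by decide
  unfold β
  exact_mod_cast hb hij

/-- Both layers are row-stochastic. [folklore] -/
theorem isRowStochastic_P (k : Fin 2) : Literature.Probability.MarkovChains.IsRowStochastic (P k) := by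
  refine ⟨fun x y => ?_, fun x => ?_⟩
  · fin_cases k <;> fin_cases x <;> fin_cases y <;> simp [P] <;> norm_num
  · fin_cases k <;> fin_cases x <;> simp [P, Fin.sum_univ_three] <;> norm_num

/-- Both layers are in detailed balance with `exp(-β_{k+1}A)`. [folklore] -/
theorem detailedBalance_P (k : Fin 2) :
    Literature.Probability.MarkovChains.DetailedBalance (fun x => Real.exp (-(β k.succ * A x))) (P k) := by
  intro x y
  simp only [β, A, exp_neg_mul_mul_log_two]
  fin_cases k <;> fin_cases x <;> fin_cases y <;> simp [P, a, b] <;> norm_num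

/-- Both layers are positive semidefinite on `ℓ²(exp(-β_{k+1}A))`: layer `0` is
`(64/21)·[(Σ w₁f)² + λ(Σ w₁φf)²]`, layer `1` is `(4096/273)·(Σ w₂ f)²`. [folklore] -/
theorem psd_P (k : Fin 2) (f : Fin 3 → ℝ) :
    0 ≤ ∑ x, ∑ y, Real.exp (-(β k.succ * A x)) * P k x y * f x * f y := by
  simp only [β, A, exp_neg_mul_mul_log_two, Fin.sum_univ_three]
  fin_cases k
  · simp [P, a, b]
    nlinarith [sq_nonneg (f 0 / 4 + f 1 / 16 + f 2 / 64),
      sq_nonneg (-(f 0 / 4) + 20 * (f 1 / 16) - 64 * (f 2 / 64))]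
  · simp [P, a, b]
    nlinarith [sq_nonneg (f 0 / 16 + f 1 / 256 + f 2 / 4096)]

/-- The perfect-relaxation value `Π_k ESS(p_{k+1}, p_k) = (63/73)·(1183/1387) = 74529/101251`. [folklore] -/
theorem rhs_eq :
    ∏ k : Fin 2, Theory2.essFrac (Exactness.gibbsLaw fun x => β k.succ * A x)
        (Exactness.gibbsLaw fun x => β k.castSucc * A x) = 74529 / 101251 := by
  simp only [Theory2.essFrac, Theory2.weight, Exactness.gibbsLaw, Exactness.partitionFn, β, A,
    exp_neg_mul_mul_log_two, Fin.sum_univ_three, Fin.prod_univ_two]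
  simp [a, b]
  norm_num

/-- The path ESS of the witness: `ESS(revPathLaw, pathLaw) = 596232/809981`. [folklore] -/
theorem lhs_eq :
    Theory2.essFrac (Theory2.revPathLaw (fun k x => β k * A x) P)
        (Exactness.pathLaw (Exactness.gibbsLaw fun x => β 0 * A x) P) = 596232 / 809981 := by
  rw [Theory2.essFrac, sum_path_three, sum_path_three]
  simp only [Theory2.weight, Theory2.revPathLaw, Theory2.revKernel, Exactness.pathLaw,
    Exactness.transProb, Exactness.gibbsLaw, Exactness.partitionFn, β, A, exp_neg_mul_mul_log_two,
    Fin.sum_univ_three, Fin.prod_univ_two]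
  simp [P, a, b, show (Fin.last 2 : Fin 3) = 2 from rfl]
  norm_num

end C3Witness

open C3Witness in
/-- **(C3′) is false** (OURS): `¬ PerfectRelaxationDominates`.  The witness is the three-state, two-layer
monotone protocol of `C3Witness` (row-stochastic, positive, reversible, positive-semidefinite layers; the first a
rank-one PSD perturbation of perfect relaxation), whose path ESS `596232/809981` EXCEEDS the perfect-relaxation
product `74529/101251`.  Classification: refuted-substantive for the hypothesis set as typed — positivity of the
layers does not control the mixed term `⟨e^{-(β₁-β₀)A}, (P₀-Π₁) e^{-2(β₂-β₁)A}⟩_{p₁}`; a repair needs a spectral /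
monotonicity hypothesis on the layers (lazy heat-bath-type layers `Π + ε(I-Π)` do satisfy the inequality).
[folklore] -/
theorem not_perfectRelaxationDominates : ¬ PerfectRelaxationDominates := by
  intro h
  have hc := h (Fin 3) 2 A β P monotone_β isRowStochastic_P detailedBalance_P psd_P
  rw [lhs_eq, rhs_eq] at hc
  norm_num at hc

end Summit.Ventures.LatticeQCDFlow.Conjectures

end
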